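import Summits.Parity.GeneralizedHardyLittlewood.Theorems.PrimeLevelFamEdgeMomentsBeyondDiagonalDiagXSqOne
import Summits.Parity.GeneralizedHardyLittlewood.Theorems.PrimeLevelFamEdgeMomentsBeyondDiagonalDiagCornerProfile
import Summits.Parity.GeneralizedHardyLittlewood.Theorems.PrimeLevelFamEdgeMomentsBeyondDiagonalDiagKernelFormProfile
import HarnessLib

/-!
# Route `PrimeLevelFamEdge`, crux K_A `MomentsBeyondDiagonal` (stmt-Parity-20007), line «petersson_layers» v4:
# **the registered stub `stub_diag : SubDiag` HOLDS AT `Q = 1` FOR EVERY ADMISSIBLE PROFILE `P`** — the diagonal part of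
# the mollified second moment beyond the diagonal CONTINUES the printed main term `secondMomentForm Δ' P 1` on `1 < Δ' ≤ 3/2`

Census item G8 (assembly at `Q = 1`) of the `stub_diag` repair census (`Lines/petersson_layers_stub_diag_g4_bricks.md`):
the `X²` instance `…DiagXSqOne.diagPart_X_sq_one_asymp` for a general admissible profile. Assembly of kernel-checked pieces:
* `DiagLines.diagPart_one_eq_trueDiagKernel_sub_offBox`: `diagPart q P 1 Δ' = 2q̂ Σ x x ((m₁m₂)^{1/2}K_true − off-box)`;
* `DiagKernel.kernelForm_profile_asymp_admissible` (this gen): the continued kernel form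
  `Σ x x kmvKernel L = ζ(2)²·secondMomentForm (log M/L) P 1/log²M + O_P(log⁻³M)`, at `M = q̂^{Δ'}`, `L = log q̂`;
* `DiagCorner.abs_corner_profile_le` (this gen): the corner `Σ x x (K_true − kmvKernel)` is `O_P(log⁻³M)` for `M ≤ Q^{3/2}`;
* the off-box remainder `≤ (Σ_i|P_i|)²·M³·92160·12!·q̂⁶q⁻⁶·Z ≪ q̂^{−3/2}`.

* `diagPart_profile_one_asymp` — **for `KMV2000.Admissible P` and `Δ' ∈ (1, 3/2]` there are `C, q₀` with
  `‖diagPart q P 1 Δ' − 2ζ(2)² q̂/(Δ'² log² q̂) · secondMomentForm Δ' P 1‖ ≤ C · q̂ · (log q̂)⁻³` for all `q ≥ q₀`**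
  (no primality needed): the `Q = 1` slice of `SubDiag` with `t = secondMomentForm`, for every admissible profile.

Helper `--supports stmt-Parity-20007`: a SPECIAL CASE (`Q = 1`) of the registered stub, not the stub (which is ∀ even-or-odd
`Q`); closes nothing; K_A, K_B and the Parity summit are NOT proved; nothing about Landau–Siegel zeros.

## References
* E. Kowalski, P. Michel, J. VanderKam, J. reine angew. Math. 526 (2000), Prop. 5.1 (31) p. 18 and (21)–(28) pp. 12–15.
  [cite: KowalskiMichelVanderKam2000, Prop. 5.1 (31) — derivation (general admissible P, Q = 1, all M up to q̂^{3/2})]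
-/

noncomputable section

open scoped Real Nat ArithmeticFunction.Moebius
open Complex Finset Polynomial
open Literature.NumberTheory.LFunctions

namespace Summit.Parity.GeneralizedHardyLittlewood.Theorems.MomentsBeyondDiagonal.DiagLines

open Summit.Parity.GeneralizedHardyLittlewood.Theorems.PrimeLevelFamEdgeIdeaDeltas.PeterssonLayers
  (afeBox diagPart one_lt_qhat summable_prod_rpow)
open Summit.Parity.GeneralizedHardyLittlewood.Theorems.BeyondDiagonalBeatsQuarter
open Summit.Parity.GeneralizedHardyLittlewood.Theorems.BeyondDiagonalBeatsQuarter.PeterssonSplit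
  (afeWeight diagCount afeWeight_nonneg)
open Summit.Parity.GeneralizedHardyLittlewood.Theorems.MomentsBeyondDiagonal.DiagKernel (kernelForm_profile_asymp_admissible)
open Summit.Parity.GeneralizedHardyLittlewood.Theorems.MomentsBeyondDiagonal.DiagCorner (abs_corner_profile_le)

/-! ## §1. The profile coefficients -/

/-- `|x_m| · τ(m) ≤ (Σ_i|P_i|)·M^{1/2}` for `x_m = μ(m)ψ(m)⁻¹m^{−1/2}P(log(M/m)/log M)`, `1 ≤ m ≤ M`
(`|μ| ≤ 1`, `ψ ≥ 1`, `0 ≤ log(M/m)/log M ≤ 1`, `τ(m) ≤ m`). [cite: KowalskiMichelVanderKam2000, (9) p. 7 — derivation] -/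
theorem abs_mollifierCoeff_mul_card_divisors_le (P : ℝ[X]) {M : ℝ} {m : ℕ} (hm : 1 ≤ m) (hmM : (m : ℝ) ≤ M) :
    |KMV2000.mollifierCoeff P M m| * (m.divisors.card : ℝ) ≤
      (∑ i ∈ Finset.range (P.natDegree + 1), |P.coeff i|) * M ^ (1 / 2 : ℝ) := by
  set SP : ℝ := ∑ i ∈ Finset.range (P.natDegree + 1), |P.coeff i| with hSP
  have hSP0 : 0 ≤ SP := Finset.sum_nonneg fun i _ ↦ abs_nonneg _
  have hm0 : (0 : ℝ) < m := by exact_mod_cast hm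
  have hm1 : (1 : ℝ) ≤ m := by exact_mod_cast hm
  have hM1 : 1 ≤ M := hm1.trans hmM
  have hM0 : 0 < M := by linarith
  -- `|x_m| ≤ SP · m^{-1/2}`
  have hx : |KMV2000.mollifierCoeff P M m| ≤ SP * (m : ℝ) ^ (-(1 / 2 : ℝ)) := by
    unfold KMV2000.mollifierCoeff
    have hμ : |(μ m : ℝ)| ≤ 1 := by
      rcases ArithmeticFunction.moebius_eq_or m with h | h | h <;> simp [h]
    have hψ : 1 ≤ KMV2000.psi m := KMV2000.one_le_psi m
    have hψinv : 0 ≤ (KMV2000.psi m)⁻¹ ∧ (KMV2000.psi m)⁻¹ ≤ 1 :=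
      ⟨inv_nonneg.mpr (zero_le_one.trans hψ), inv_le_one_of_one_le₀ hψ⟩
    have hlm : 0 ≤ Real.log (M / m) := Real.log_nonneg (by rw [le_div_iff₀ hm0]; linarith)
    have hlm' : Real.log (M / m) ≤ Real.log M := by
      rw [Real.log_div hM0.ne' hm0.ne']
      linarith [Real.log_nonneg hm1]
    have hlM : 0 ≤ Real.log M := Real.log_nonneg hM1
    have hu0 : 0 ≤ Real.log (M / m) / Real.log M := div_nonneg hlm hlM
    have hu1 : Real.log (M / m) / Real.log M ≤ 1 := by
      rcases eq_or_lt_of_le hlM with h | h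
      · rw [← h]; simp
      · rw [div_le_one h]; exact hlm'
    have hPe : |P.eval (Real.log (M / m) / Real.log M)| ≤ SP := by
      rw [hSP, Polynomial.eval_eq_sum_range]
      refine (Finset.abs_sum_le_sum_abs _ _).trans (Finset.sum_le_sum fun i _ ↦ ?_)
      rw [abs_mul, abs_pow, abs_of_nonneg hu0]
      exact mul_le_of_le_one_right (abs_nonneg _) (pow_le_one₀ hu0 hu1)
    have hr0 : 0 ≤ (m : ℝ) ^ (-(1 / 2 : ℝ)) := Real.rpow_nonneg hm0.le _
    rw [abs_mul, abs_mul, abs_mul, abs_of_nonneg hψinv.1, abs_of_nonneg hr0]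
    calc |(μ m : ℝ)| * ((KMV2000.psi m)⁻¹ * (m : ℝ) ^ (-(1 / 2 : ℝ)) *
          |P.eval (Real.log (M / m) / Real.log M)|)
        ≤ 1 * (1 * (m : ℝ) ^ (-(1 / 2 : ℝ)) * SP) := by gcongr; exact hψinv.2
      _ = SP * (m : ℝ) ^ (-(1 / 2 : ℝ)) := by ring
  have hτ : (m.divisors.card : ℝ) ≤ m := by exact_mod_cast Nat.card_divisors_le_self m
  calc |KMV2000.mollifierCoeff P M m| * (m.divisors.card : ℝ)
      ≤ SP * (m : ℝ) ^ (-(1 / 2 : ℝ)) * m := mul_le_mul hx hτ (Nat.cast_nonneg _) (by positivity)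
    _ = SP * ((m : ℝ) ^ (-(1 / 2 : ℝ)) * m) := by ring
    _ = SP * (m : ℝ) ^ (1 / 2 : ℝ) := by
        congr 1
        conv_lhs => rw [show (m : ℝ) = (m : ℝ) ^ (1 : ℝ) by rw [Real.rpow_one], ← Real.rpow_mul hm0.le,
          ← Real.rpow_add hm0]
        norm_num
    _ ≤ SP * M ^ (1 / 2 : ℝ) := mul_le_mul_of_nonneg_left (Real.rpow_le_rpow hm0.le hmM (by norm_num)) hSP0

/-- For `m₁, m₂ ≥ 1`: `x_{m₁}x_{m₂}·(m₁m₂)^{1/2}·K = x′_{m₁}x′_{m₂}·K` with `x′_m = μ(m)ψ(m)⁻¹P(log(M/m)/log M) = m^{1/2}x_m`.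
[cite: KowalskiMichelVanderKam2000, (9) p. 7 — derivation] -/
theorem mollifierCoeff_mul_sqrt (P : ℝ[X]) {M : ℝ} {m₁ m₂ : ℕ} (h₁ : m₁ ≠ 0) (h₂ : m₂ ≠ 0) (K : ℝ) :
    KMV2000.mollifierCoeff P M m₁ * KMV2000.mollifierCoeff P M m₂ * ((((m₁ : ℝ) * m₂) ^ (1 / 2 : ℝ)) * K) =
      ((μ m₁ : ℝ) * ((KMV2000.psi m₁)⁻¹ * P.eval (Real.log (M / m₁) / Real.log M))) *
        ((μ m₂ : ℝ) * ((KMV2000.psi m₂)⁻¹ * P.eval (Real.log (M / m₂) / Real.log M))) * K := by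
  have hm₁ : (0 : ℝ) < m₁ := by exact_mod_cast Nat.pos_of_ne_zero h₁
  have hm₂ : (0 : ℝ) < m₂ := by exact_mod_cast Nat.pos_of_ne_zero h₂
  have hprod : (m₁ : ℝ) ^ (-(1 / 2 : ℝ)) * (m₂ : ℝ) ^ (-(1 / 2 : ℝ)) * (((m₁ : ℝ) * m₂) ^ (1 / 2 : ℝ)) = 1 := by
    rw [Real.mul_rpow hm₁.le hm₂.le, show (m₁ : ℝ) ^ (-(1 / 2 : ℝ)) * (m₂ : ℝ) ^ (-(1 / 2 : ℝ)) *
        ((m₁ : ℝ) ^ (1 / 2 : ℝ) * (m₂ : ℝ) ^ (1 / 2 : ℝ)) =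
        ((m₁ : ℝ) ^ (-(1 / 2 : ℝ)) * (m₁ : ℝ) ^ (1 / 2 : ℝ)) * ((m₂ : ℝ) ^ (-(1 / 2 : ℝ)) * (m₂ : ℝ) ^ (1 / 2 : ℝ)) by ring,
      ← Real.rpow_add hm₁, ← Real.rpow_add hm₂]
    norm_num
  unfold KMV2000.mollifierCoeff
  linear_combination ((μ m₁ : ℝ) * ((KMV2000.psi m₁)⁻¹ * P.eval (Real.log (M / m₁) / Real.log M))) *
    ((μ m₂ : ℝ) * ((KMV2000.psi m₂)⁻¹ * P.eval (Real.log (M / m₂) / Real.log M))) * K * hprod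

/-! ## §2. `SubDiag` at `Q = 1` for every admissible profile -/

/-- **THE DIAGONAL PART BEYOND THE DIAGONAL FOR EVERY ADMISSIBLE PROFILE (`SubDiag` at `Q = 1`).** For
`KMV2000.Admissible P` and `Δ' ∈ (1, 3/2]` there are `C, q₀` such that for all `q ≥ q₀` (no primality needed),
`‖diagPart q P 1 Δ' − 2ζ(2)² q̂/(Δ'² log² q̂) · secondMomentForm Δ' P 1‖ ≤ C · q̂ · (log q̂)⁻³`:
the diagonal main term of the mollified second moment at `Q = 1` CONTINUES the printed (`Δ < 1`) form (31) beyond the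
diagonal, for every admissible profile — the `Q = 1` slice of the registered stub `stub_diag : SubDiag` of the line
«petersson_layers» with `t = secondMomentForm`.
[cite: KowalskiMichelVanderKam2000, Prop. 5.1 (31) p. 18 and (23)–(28) pp. 13–15 — derivation (general admissible P, Q = 1, all M up to q̂^{3/2})] -/
theorem diagPart_profile_one_asymp {P : ℝ[X]} (hP : KMV2000.Admissible P) {Δ' : ℝ} (h1 : 1 < Δ') (h32 : Δ' ≤ 3 / 2) :
    ∃ C : ℝ, ∃ q₀ : ℕ, ∀ (q : ℕ) [NeZero q], q₀ ≤ q →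
      ‖diagPart q P 1 Δ' -
          ((2 * riemannZeta 2 ^ 2 *
              ((KMV2000.qhat q / (Δ' ^ 2 * Real.log (KMV2000.qhat q) ^ 2) : ℝ) : ℂ)) *
            ((KMV2000.secondMomentForm Δ' P 1 : ℝ) : ℂ))‖ ≤
        C * KMV2000.qhat q * (Real.log (KMV2000.qhat q))⁻¹ ^ 3 := by
  -- constants
  have hP0 : P.coeff 0 = 0 := by rw [Polynomial.coeff_zero_eq_eval_zero]; exact hP.1
  obtain ⟨C₁, hC₁0, hcorner⟩ := abs_corner_profile_le P hP0 (by norm_num : (0 : ℝ) < 1 / 2)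
  obtain ⟨C₂, hC₂0, hkernel⟩ := kernelForm_profile_asymp_admissible hP
  set SP : ℝ := ∑ i ∈ Finset.range (P.natDegree + 1), |P.coeff i| with hSP
  have hSP0 : 0 ≤ SP := Finset.sum_nonneg fun i _ ↦ abs_nonneg _
  set Z : ℝ := ∑' n : ℕ × ℕ, ((n.1 : ℝ)) ^ (-(5 / 2 : ℝ)) * ((n.2 : ℝ)) ^ (-(5 / 2 : ℝ)) with hZ
  have hZ0 : 0 ≤ Z := tsum_nonneg fun n ↦ mul_nonneg (Real.rpow_nonneg (Nat.cast_nonneg _) _)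
    (Real.rpow_nonneg (Nat.cast_nonneg _) _)
  set cW : ℝ := 92160 * (12 ! : ℝ) with hcW
  -- the level threshold: `q̂ ≥ 3` and `q ≥ 64`
  obtain ⟨q₁, hq₁⟩ := exists_le_qhat 3
  refine ⟨2 * ((C₁ + C₂) + SP ^ 2 * (8 * (cW * Z))), max q₁ 64, fun q _ hq ↦ ?_⟩
  -- level facts
  have hq₁' : q₁ ≤ q := (le_max_left _ _).trans hq
  have hq64 : 64 ≤ q := (le_max_right _ _).trans hq
  have hQ := hq₁ q hq₁'
  set Q : ℝ := KMV2000.qhat q with hQdef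
  have hQ3 : 3 ≤ Q := hQ
  have hQ2 : 2 ≤ Q := by linarith
  have hQ1 : 1 < Q := by linarith
  have hQ0 : 0 < Q := by linarith
  set ℓ : ℝ := Real.log Q with hℓ
  have hℓ0 : 0 < ℓ := Real.log_pos hQ1
  set M : ℝ := Q ^ Δ' with hMdef
  have hΔ0 : 0 < Δ' := by linarith
  have hQM : Q ≤ M := by
    calc Q = Q ^ (1 : ℝ) := (Real.rpow_one Q).symm
      _ ≤ Q ^ Δ' := Real.rpow_le_rpow_of_exponent_le hQ1.le h1.le
  have hM2 : 2 ≤ M := hQ2.trans hQM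
  have hM3 : 3 ≤ M := hQ3.trans hQM
  have hM32 : M ≤ Q ^ (2 - 1 / 2 : ℝ) := by
    rw [show (2 - 1 / 2 : ℝ) = 3 / 2 by norm_num]
    exact Real.rpow_le_rpow_of_exponent_le hQ1.le h32
  have hlogM : Real.log M = Δ' * ℓ := by rw [hMdef, Real.log_rpow hQ0]
  have hlogM0 : 0 < Real.log M := by rw [hlogM]; positivity
  have hLlogM : ℓ ≤ Real.log M := by rw [hlogM]; nlinarith
  have hsm : KMV2000.secondMomentForm (Real.log M / ℓ) P 1 = KMV2000.secondMomentForm Δ' P 1 := by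
    rw [hlogM, mul_div_assoc, div_self hℓ0.ne', mul_one]
  -- (1) the two kernel bounds
  have hc := hcorner Q M hQ2 hM2 hM32
  have hk := hkernel M hM3 ℓ hℓ0.le hLlogM
  rw [hsm] at hk
  -- (2) the off-box remainder
  have hq1 : 1 ≤ q := le_trans (by norm_num) hq64
  set T : ℕ → ℕ → ℝ := fun m₁ m₂ ↦ ∑' n : ↑((afeBox q ×ˢ afeBox q : Finset (ℕ × ℕ)) : Set (ℕ × ℕ))ᶜ,
    afeWeight q n * (diagCount m₁ m₂ n : ℝ) with hT
  set ε : ℝ := ∑' n : ↑((afeBox q ×ˢ afeBox q : Finset (ℕ × ℕ)) : Set (ℕ × ℕ))ᶜ, afeWeight q n with hε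
  have hε0 : 0 ≤ ε := tsum_nonneg fun n ↦ afeWeight_nonneg q n
  have hεle : ε ≤ cW * Q ^ (6 : ℝ) * ((q : ℝ)) ^ (-(6 : ℝ)) * Z := by
    have := tsum_offBox_afeWeight_le (q := q) hq1
    simpa [hε, hcW, hZ, mul_assoc] using this
  -- `Q^6 q^{-6} ≤ Q^{-6}` (`Q² ≤ q`)
  have hq0 : (0 : ℝ) < q := by exact_mod_cast (show 0 < q by omega)
  have hQsq : Q ^ 2 ≤ (q : ℝ) := by
    have h := KMV2000.qhat_le_sqrt (q := q)
    calc Q ^ 2 ≤ Real.sqrt q ^ 2 := pow_le_pow_left₀ hQ0.le h 2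
      _ = q := Real.sq_sqrt hq0.le
  have hlevel : Q ^ (6 : ℝ) * ((q : ℝ)) ^ (-(6 : ℝ)) ≤ Q ^ (-(6 : ℝ)) := by
    have h1 : ((q : ℝ)) ^ (-(6 : ℝ)) ≤ (Q ^ 2) ^ (-(6 : ℝ)) := Real.rpow_le_rpow_of_nonpos (by positivity) hQsq (by norm_num)
    have h2 : (Q ^ 2) ^ (-(6 : ℝ)) = Q ^ (-(12 : ℝ)) := by
      rw [← Real.rpow_natCast Q 2, ← Real.rpow_mul hQ0.le]; norm_num
    calc Q ^ (6 : ℝ) * ((q : ℝ)) ^ (-(6 : ℝ)) ≤ Q ^ (6 : ℝ) * Q ^ (-(12 : ℝ)) := by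
          rw [← h2]; exact mul_le_mul_of_nonneg_left h1 (Real.rpow_nonneg hQ0.le _)
      _ = Q ^ (-(6 : ℝ)) := by rw [← Real.rpow_add hQ0]; norm_num
  -- `|Σ x x T| ≤ SP² M³ ε`
  have hsumxτ : ∑ m ∈ Icc 1 ⌊M⌋₊, |KMV2000.mollifierCoeff P M m| * (m.divisors.card : ℝ) ≤ SP * M ^ (3 / 2 : ℝ) := by
    have hM0 : 0 ≤ M := by linarith
    calc ∑ m ∈ Icc 1 ⌊M⌋₊, |KMV2000.mollifierCoeff P M m| * (m.divisors.card : ℝ)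
        ≤ ∑ m ∈ Icc 1 ⌊M⌋₊, SP * M ^ (1 / 2 : ℝ) := by
          refine Finset.sum_le_sum fun m hm ↦ ?_
          have hm' := Finset.mem_Icc.mp hm
          exact abs_mollifierCoeff_mul_card_divisors_le P hm'.1
            ((Nat.cast_le.mpr hm'.2).trans (Nat.floor_le hM0))
      _ = (⌊M⌋₊ : ℝ) * (SP * M ^ (1 / 2 : ℝ)) := by simp
      _ ≤ M * (SP * M ^ (1 / 2 : ℝ)) := by gcongr; exact Nat.floor_le hM0
      _ = SP * (M * M ^ (1 / 2 : ℝ)) := by ring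
      _ = SP * M ^ (3 / 2 : ℝ) := by
          congr 1
          conv_lhs => rw [show M = M ^ (1 : ℝ) by rw [Real.rpow_one], ← Real.rpow_mul hM0, ← Real.rpow_add (by linarith)]
          norm_num
  have hE : |∑ m₁ ∈ Icc 1 ⌊M⌋₊, ∑ m₂ ∈ Icc 1 ⌊M⌋₊,
      KMV2000.mollifierCoeff P M m₁ * KMV2000.mollifierCoeff P M m₂ * T m₁ m₂| ≤ SP ^ 2 * (M ^ (3 : ℝ) * ε) := by
    have hterm : ∀ m₁ ∈ Icc 1 ⌊M⌋₊, ∀ m₂ ∈ Icc 1 ⌊M⌋₊,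
        |KMV2000.mollifierCoeff P M m₁ * KMV2000.mollifierCoeff P M m₂ * T m₁ m₂| ≤
          (|KMV2000.mollifierCoeff P M m₁| * (m₁.divisors.card : ℝ)) *
            (|KMV2000.mollifierCoeff P M m₂| * (m₂.divisors.card : ℝ)) * ε := by
      intro m₁ hm₁ m₂ hm₂
      have hm₁0 : m₁ ≠ 0 := by have := (Finset.mem_Icc.mp hm₁).1; omega
      have hm₂0 : m₂ ≠ 0 := by have := (Finset.mem_Icc.mp hm₂).1; omega
      have hT0 : 0 ≤ T m₁ m₂ := tsum_offBox_diagCount_nonneg q m₁ m₂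
      have hTle : T m₁ m₂ ≤ ((m₁.divisors.card * m₂.divisors.card : ℕ) : ℝ) * ε := tsum_offBox_diagCount_le hq1 hm₁0 hm₂0
      rw [abs_mul, abs_mul, abs_of_nonneg hT0]
      calc |KMV2000.mollifierCoeff P M m₁| * |KMV2000.mollifierCoeff P M m₂| * T m₁ m₂
          ≤ |KMV2000.mollifierCoeff P M m₁| * |KMV2000.mollifierCoeff P M m₂| *
              (((m₁.divisors.card * m₂.divisors.card : ℕ) : ℝ) * ε) := by gcongr
        _ = _ := by push_cast; ring
    calc |∑ m₁ ∈ Icc 1 ⌊M⌋₊, ∑ m₂ ∈ Icc 1 ⌊M⌋₊,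
          KMV2000.mollifierCoeff P M m₁ * KMV2000.mollifierCoeff P M m₂ * T m₁ m₂|
        ≤ ∑ m₁ ∈ Icc 1 ⌊M⌋₊, ∑ m₂ ∈ Icc 1 ⌊M⌋₊,
          (|KMV2000.mollifierCoeff P M m₁| * (m₁.divisors.card : ℝ)) *
            (|KMV2000.mollifierCoeff P M m₂| * (m₂.divisors.card : ℝ)) * ε := by
          refine (Finset.abs_sum_le_sum_abs _ _).trans (Finset.sum_le_sum fun m₁ hm₁ ↦ ?_)
          exact (Finset.abs_sum_le_sum_abs _ _).trans (Finset.sum_le_sum fun m₂ hm₂ ↦ hterm m₁ hm₁ m₂ hm₂)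
      _ = (∑ m ∈ Icc 1 ⌊M⌋₊, |KMV2000.mollifierCoeff P M m| * (m.divisors.card : ℝ)) *
            (∑ m ∈ Icc 1 ⌊M⌋₊, |KMV2000.mollifierCoeff P M m| * (m.divisors.card : ℝ)) * ε := by
          rw [Finset.sum_mul_sum, Finset.sum_mul]
          exact Finset.sum_congr rfl fun m₁ _ ↦ by rw [Finset.sum_mul]
      _ ≤ (SP * M ^ (3 / 2 : ℝ)) * (SP * M ^ (3 / 2 : ℝ)) * ε := by
          have h0 : 0 ≤ ∑ m ∈ Icc 1 ⌊M⌋₊, |KMV2000.mollifierCoeff P M m| * (m.divisors.card : ℝ) :=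
            Finset.sum_nonneg fun m _ ↦ mul_nonneg (abs_nonneg _) (Nat.cast_nonneg _)
          exact mul_le_mul_of_nonneg_right (mul_le_mul hsumxτ hsumxτ h0 (h0.trans hsumxτ)) hε0
      _ = SP ^ 2 * (M ^ (3 : ℝ) * ε) := by
          rw [show (SP * M ^ (3 / 2 : ℝ)) * (SP * M ^ (3 / 2 : ℝ)) * ε =
              SP ^ 2 * ((M ^ (3 / 2 : ℝ) * M ^ (3 / 2 : ℝ)) * ε) by ring, ← Real.rpow_add (by linarith : (0 : ℝ) < M)]
          norm_num
  -- `M³ ε ≤ 8 cW Z · ℓ⁻³`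
  have hM3 : M ^ (3 : ℝ) ≤ Q ^ (9 / 2 : ℝ) := by
    rw [hMdef, ← Real.rpow_mul hQ0.le]
    exact Real.rpow_le_rpow_of_exponent_le hQ1.le (by nlinarith)
  have hoff : M ^ (3 : ℝ) * ε ≤ 8 * (cW * Z) * ℓ⁻¹ ^ 3 := by
    have hlog3 := log_qhat_pow_three_le hQ1.le
    have hstep1 : M ^ (3 : ℝ) * ε ≤ Q ^ (9 / 2 : ℝ) * (cW * Z * Q ^ (-(6 : ℝ))) := by
      calc M ^ (3 : ℝ) * ε ≤ Q ^ (9 / 2 : ℝ) * (cW * Q ^ (6 : ℝ) * ((q : ℝ)) ^ (-(6 : ℝ)) * Z) :=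
            mul_le_mul hM3 hεle hε0 (Real.rpow_nonneg hQ0.le _)
        _ = Q ^ (9 / 2 : ℝ) * (cW * Z * (Q ^ (6 : ℝ) * ((q : ℝ)) ^ (-(6 : ℝ)))) := by ring
        _ ≤ Q ^ (9 / 2 : ℝ) * (cW * Z * Q ^ (-(6 : ℝ))) := by gcongr
    have hstep2 : Q ^ (9 / 2 : ℝ) * (cW * Z * Q ^ (-(6 : ℝ))) = cW * Z * Q ^ (-(3 / 2 : ℝ)) := by
      rw [show Q ^ (9 / 2 : ℝ) * (cW * Z * Q ^ (-(6 : ℝ))) = cW * Z * (Q ^ (9 / 2 : ℝ) * Q ^ (-(6 : ℝ))) by ring,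
        ← Real.rpow_add hQ0]
      norm_num
    have hstep3 : Q ^ (-(3 / 2 : ℝ)) ≤ 8 * ℓ⁻¹ ^ 3 := by
      rw [Real.rpow_neg hQ0.le, inv_pow, ← div_eq_mul_inv, le_div_iff₀ (pow_pos hℓ0 3)]
      calc (Q ^ (3 / 2 : ℝ))⁻¹ * ℓ ^ 3 ≤ (Q ^ (3 / 2 : ℝ))⁻¹ * (8 * Q ^ (3 / 2 : ℝ)) := by gcongr
        _ = 8 := by field_simp
    calc M ^ (3 : ℝ) * ε ≤ cW * Z * Q ^ (-(3 / 2 : ℝ)) := hstep1.trans hstep2.le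
      _ ≤ cW * Z * (8 * ℓ⁻¹ ^ 3) := by gcongr
      _ = 8 * (cW * Z) * ℓ⁻¹ ^ 3 := by ring
  -- (3) the main term
  have hmain : ((2 * riemannZeta 2 ^ 2 * ((Q / (Δ' ^ 2 * ℓ ^ 2) : ℝ) : ℂ)) *
      ((KMV2000.secondMomentForm Δ' P 1 : ℝ) : ℂ)) =
      (((2 * Q * ((π ^ 2 / 6) ^ 2 * KMV2000.secondMomentForm Δ' P 1 / Real.log M ^ 2)) : ℝ) : ℂ) := by
    have hℓC : (ℓ : ℂ) ≠ 0 := by exact_mod_cast hℓ0.ne'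
    have hΔC : (Δ' : ℂ) ≠ 0 := by exact_mod_cast hΔ0.ne'
    rw [riemannZeta_two, hlogM]
    push_cast
    field_simp
  -- (4) assemble in `ℝ`
  rw [diagPart_one_eq_trueDiagKernel_sub_offBox hq1, hmain, ← Complex.ofReal_sub, Complex.norm_real, Real.norm_eq_abs]
  set xP : ℕ → ℝ := fun m ↦ (μ m : ℝ) * ((KMV2000.psi m)⁻¹ * P.eval (Real.log (M / m) / Real.log M)) with hxP
  have hsplit : 2 * Q * ∑ m₁ ∈ Icc 1 ⌊M⌋₊, ∑ m₂ ∈ Icc 1 ⌊M⌋₊,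
      KMV2000.mollifierCoeff P M m₁ * KMV2000.mollifierCoeff P M m₂ *
        ((((m₁ : ℝ) * m₂) ^ (1 / 2 : ℝ) * Corner.trueDiagKernel Q m₁ m₂) - T m₁ m₂) -
      2 * Q * ((π ^ 2 / 6) ^ 2 * KMV2000.secondMomentForm Δ' P 1 / Real.log M ^ 2) =
      2 * Q * ((∑ a ∈ Icc 1 ⌊M⌋₊, ∑ b ∈ Icc 1 ⌊M⌋₊,
          xP a * xP b * (Corner.trueDiagKernel Q a b - KMV2000.kmvKernel (Real.log Q) a b)) +
        (∑ a ∈ Icc 1 ⌊M⌋₊, ∑ b ∈ Icc 1 ⌊M⌋₊, xP a * xP b * KMV2000.kmvKernel ℓ a b -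
          (π ^ 2 / 6) ^ 2 * KMV2000.secondMomentForm Δ' P 1 / Real.log M ^ 2) -
        ∑ m₁ ∈ Icc 1 ⌊M⌋₊, ∑ m₂ ∈ Icc 1 ⌊M⌋₊,
          KMV2000.mollifierCoeff P M m₁ * KMV2000.mollifierCoeff P M m₂ * T m₁ m₂) := by
    have hS : ∑ m₁ ∈ Icc 1 ⌊M⌋₊, ∑ m₂ ∈ Icc 1 ⌊M⌋₊,
        KMV2000.mollifierCoeff P M m₁ * KMV2000.mollifierCoeff P M m₂ *
          ((((m₁ : ℝ) * m₂) ^ (1 / 2 : ℝ) * Corner.trueDiagKernel Q m₁ m₂) - T m₁ m₂) =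
        ∑ a ∈ Icc 1 ⌊M⌋₊, ∑ b ∈ Icc 1 ⌊M⌋₊, xP a * xP b * Corner.trueDiagKernel Q a b -
        ∑ m₁ ∈ Icc 1 ⌊M⌋₊, ∑ m₂ ∈ Icc 1 ⌊M⌋₊,
          KMV2000.mollifierCoeff P M m₁ * KMV2000.mollifierCoeff P M m₂ * T m₁ m₂ := by
      rw [← Finset.sum_sub_distrib]
      refine Finset.sum_congr rfl fun m₁ hm₁ ↦ ?_
      rw [← Finset.sum_sub_distrib]
      refine Finset.sum_congr rfl fun m₂ hm₂ ↦ ?_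
      have hm₁0 : m₁ ≠ 0 := by have := (Finset.mem_Icc.mp hm₁).1; omega
      have hm₂0 : m₂ ≠ 0 := by have := (Finset.mem_Icc.mp hm₂).1; omega
      rw [mul_sub, mollifierCoeff_mul_sqrt P hm₁0 hm₂0]
    have hK : ∑ a ∈ Icc 1 ⌊M⌋₊, ∑ b ∈ Icc 1 ⌊M⌋₊, xP a * xP b * Corner.trueDiagKernel Q a b =
        ∑ a ∈ Icc 1 ⌊M⌋₊, ∑ b ∈ Icc 1 ⌊M⌋₊,
          xP a * xP b * (Corner.trueDiagKernel Q a b - KMV2000.kmvKernel (Real.log Q) a b) +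
        ∑ a ∈ Icc 1 ⌊M⌋₊, ∑ b ∈ Icc 1 ⌊M⌋₊, xP a * xP b * KMV2000.kmvKernel ℓ a b := by
      rw [← Finset.sum_add_distrib]
      refine Finset.sum_congr rfl fun a _ ↦ ?_
      rw [← Finset.sum_add_distrib]
      refine Finset.sum_congr rfl fun b _ ↦ ?_
      rw [hℓ]; ring
    rw [hS, hK]; ring
  rw [hsplit, abs_mul, abs_of_pos (by positivity : (0 : ℝ) < 2 * Q)]
  simp only [hxP] at hc hk ⊢
  have htri : |(∑ a ∈ Icc 1 ⌊M⌋₊, ∑ b ∈ Icc 1 ⌊M⌋₊,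
          ((μ a : ℝ) * ((KMV2000.psi a)⁻¹ * P.eval (Real.log (M / a) / Real.log M))) *
            ((μ b : ℝ) * ((KMV2000.psi b)⁻¹ * P.eval (Real.log (M / b) / Real.log M))) *
            (Corner.trueDiagKernel Q a b - KMV2000.kmvKernel (Real.log Q) a b)) +
        (∑ a ∈ Icc 1 ⌊M⌋₊, ∑ b ∈ Icc 1 ⌊M⌋₊,
          ((μ a : ℝ) * ((KMV2000.psi a)⁻¹ * P.eval (Real.log (M / a) / Real.log M))) *
            ((μ b : ℝ) * ((KMV2000.psi b)⁻¹ * P.eval (Real.log (M / b) / Real.log M))) *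
            KMV2000.kmvKernel ℓ a b -
          (π ^ 2 / 6) ^ 2 * KMV2000.secondMomentForm Δ' P 1 / Real.log M ^ 2) -
        ∑ m₁ ∈ Icc 1 ⌊M⌋₊, ∑ m₂ ∈ Icc 1 ⌊M⌋₊,
          KMV2000.mollifierCoeff P M m₁ * KMV2000.mollifierCoeff P M m₂ * T m₁ m₂| ≤
      C₁ / Real.log M ^ 3 + C₂ / Real.log M ^ 3 + SP ^ 2 * (M ^ (3 : ℝ) * ε) := by
    refine (abs_sub _ _).trans (add_le_add ((abs_add_le _ _).trans (add_le_add hc hk)) hE)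
  -- `1/log³ M ≤ ℓ⁻³`
  have hlogM3 : ∀ {C : ℝ}, 0 ≤ C → C / Real.log M ^ 3 ≤ C * ℓ⁻¹ ^ 3 := by
    intro C hC
    rw [inv_pow, ← div_eq_mul_inv]
    exact div_le_div_of_nonneg_left hC (pow_pos hℓ0 3) (pow_le_pow_left₀ hℓ0.le hLlogM 3)
  refine (mul_le_mul_of_nonneg_left htri (by positivity)).trans ?_
  calc 2 * Q * (C₁ / Real.log M ^ 3 + C₂ / Real.log M ^ 3 + SP ^ 2 * (M ^ (3 : ℝ) * ε))
      ≤ 2 * Q * (C₁ * ℓ⁻¹ ^ 3 + C₂ * ℓ⁻¹ ^ 3 + SP ^ 2 * (8 * (cW * Z) * ℓ⁻¹ ^ 3)) := by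
        gcongr
        · exact hlogM3 hC₁0.le
        · exact hlogM3 hC₂0.le
    _ = 2 * ((C₁ + C₂) + SP ^ 2 * (8 * (cW * Z))) * Q * ℓ⁻¹ ^ 3 := by ring

end Summit.Parity.GeneralizedHardyLittlewood.Theorems.MomentsBeyondDiagonal.DiagLines

end
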